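import Summits.AnomalousDissipation.AnomalousDissipation.Theorems.BaireTransferRobustLoudUpgradeStubSteadyWindowLeaf

/-!
# Stub `stub_steadyWindowNear` of the line `malkin-cone-group-orbits`
# (crux stmt-AnomalousDissipation-1144, `BaireTransfer.RobustLoudUpgrade`; companion c5, "the intrinsic unfolding")

The WINDOW of the companion c5, with MOVING viscosity.  A classical steady state `u₀` of
`NS_ν(f_c)`, `ν ∈ (0,a)`, of any spatial mean, with STRICT budgets `∫‖u₀‖² < E`, `ν‖∇u₀‖₂² > ε`,
all of whose neighbouring forces `f_{c'}` carry classical steady states `u'` at SOME viscosity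
`ν'` with `(ν', u')` arbitrarily close to `(ν, u₀)` in `ℝ × H¹` (`|ν' − ν| < δ`,
`h1DistSq u' u₀ < δ` on a ball of radius `r(δ)` around `c`, every `δ > 0`), is an interior point
of `loud S a E ε`: `t ↦ u'` is a `1`-periodic classical solution of `NS_{ν'}(f_{c'})`, and its
budgets `∫‖u'‖²`, `ν'‖∇u'‖₂²` stay within the strict slack of those of `u₀`.

This is verbatim the argument of the landed template `stub_steadyWindowLeaf`
(`Theorems/BaireTransferRobustLoudUpgradeStubSteadyWindowLeaf.lean`) with two changes: the
persistence hypothesis is in Pi-form and also moves the viscosity, so `δ` is chosen in addition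
with `δ < ν`, `δ < a − ν` (whence `0 < ν' < a`) and with
`(1+η)ε < (ν − δ)(‖∇u₀‖₂² − (1+η⁻¹)δ)`, which absorbs at once the `H¹`-perturbation
(Peter–Paul, `‖∇u₀‖₂² ≤ (1+η)‖∇u'‖₂² + (1+η⁻¹)‖∇(u' − u₀)‖₂²`) and the factor `ν'/ν ≥ (ν − δ)/ν`
in the dissipation `ν'‖∇u'‖₂²`.  The elementary helpers `integral_norm_sq_le`, `gradNormSq_le`,
`meanEnergy_const`, `meanDissipation_const` are those of
`Theorems/BaireTransferRobustLoudUpgradeStubSteadyWindow.lean`.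

References: Temam, *Navier–Stokes Equations* (1979) Ch. II §1 (steady states); the vocabulary
module `Theorems/BaireTransferRobustLoudUpgradeLine.lean` (`Coeff`, `force`, `loud`, `h1DistSq`);
pattern from `Cruxes/RobustLoudUpgrade/Disproof.lean` §6 (`cLam_mem_loud`).
-/

-- `Summit.<Summit>.<Problem>` is the tree's mandated summit-side namespace (CONVENTIONS §2); for this
-- single-conjunct summit the two coincide, so the duplicate is deliberate.
set_option linter.dupNamespace false

noncomputable section

open scoped BigOperators Topology
open Filter Set Function TopologicalSpace MeasureTheory

namespace Summit.AnomalousDissipation.AnomalousDissipation.Theorems.RobustLoudUpgrade.SteadyWindowNear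

open Literature.Analysis.FunctionSpaces Literature.Analysis.FunctionSpaces.Torus
open Literature.Analysis.FluidPDE
open Summit.AnomalousDissipation.AnomalousDissipation.Theses.BaireTransfer
open Summit.AnomalousDissipation.AnomalousDissipation.Theorems.RobustLoudUpgrade.SteadyWindow

/-! ## The stub -/

/-- **Steady window with moving viscosity** (registered stub `stub_steadyWindowNear` of the line
`malkin-cone-group-orbits`, companion c5): a classical steady witness `u₀` of `NS_ν(f_c)`,
`ν ∈ (0,a)`, with strict budgets `meanEnergy < E`, `meanDissipation > ε`, all of whose
neighbouring forces carry classical steady states `(ν', u')` arbitrarily close to `(ν, u₀)` in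
`ℝ × H¹`, is an interior point of `loud S a E ε`.  Proof: pick `η > 0` inside the strict slack
(`(1+η)∫‖u₀‖² < E`, `(1+η)ε < ν‖∇u₀‖₂²`), then `δ > 0` with `δ < ν`, `δ < a − ν`,
`(1+η)∫‖u₀‖² + (1+η⁻¹)δ < E` and `(1+η)ε < (ν − δ)(‖∇u₀‖₂² − (1+η⁻¹)δ)`; on the ball of radius
`r(δ)` every force carries a steady `u'` at some `ν' ∈ (ν − δ, ν + δ) ⊆ (0,a)` with
`h1DistSq u' u₀ < δ`, and `t ↦ u'` is a `1`-periodic classical loud witness at `ν'` by Peter–Paul.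
[folklore] -/
theorem stub_steadyWindowNear : ∀ (S : Finset (Fin 3 → ℤ)) (a E ε : ℝ) (c : Coeff S) (ν : ℝ) (u₀ : UnitAddTorus (Fin 3) → EuclideanSpace ℝ (Fin 3)) (p₀ : UnitAddTorus (Fin 3) → ℝ), 0 < ν → ν < a → Torus.IsSteadyNSState ν (force S c) u₀ p₀ → meanEnergy (fun _ : ℝ => u₀) < E → ε < meanDissipation ν (fun _ : ℝ => u₀) → (∀ δ : ℝ, 0 < δ → ∃ r : ℝ, 0 < r ∧ ∀ c' : Coeff S, dist c' c < r → ∃ (ν' : ℝ) (u' : UnitAddTorus (Fin 3) → EuclideanSpace ℝ (Fin 3)) (p' : UnitAddTorus (Fin 3) → ℝ), |ν' - ν| < δ ∧ Torus.IsSteadyNSState ν' (force S c') u' p' ∧ h1DistSq u' u₀ < δ) → c ∈ interior (loud S a E ε) := by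
  intro S a E ε c ν u₀ p₀ hν hνa hst hE hε hpers
  have hsm₀ : IsSmooth u₀ := hst.smooth_velocity.isSmooth_slice (Set.mem_univ (0 : ℝ))
  -- the budgets of `u₀`, as integrals over `T³`
  set A₀ : ℝ := ∫ x, ‖u₀ x‖ ^ 2
  set G₀ : ℝ := gradNormSq u₀
  have hA : A₀ < E := by rwa [meanEnergy_const] at hE
  have hG : ε < ν * G₀ := by rwa [meanDissipation_const ν hsm₀] at hε
  -- slack: `η > 0` with `(1+η)A₀ < E`, `(1+η)ε < νG₀`
  obtain ⟨η, ⟨hηE, hηε⟩, hη0⟩ :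
      ∃ η : ℝ, ((1 + η) * A₀ < E ∧ (1 + η) * ε < ν * G₀) ∧ 0 < η := by
    have h1 : ∀ᶠ η : ℝ in 𝓝 0, (1 + η) * A₀ < E :=
      Filter.Tendsto.eventually_lt_const (v := (1 + 0) * A₀) (by simpa using hA)
        (((continuous_const.add continuous_id).mul continuous_const).tendsto' _ _ rfl)
    have h2 : ∀ᶠ η : ℝ in 𝓝 0, (1 + η) * ε < ν * G₀ :=
      Filter.Tendsto.eventually_lt_const (v := (1 + 0) * ε) (by simpa using hG)
        (((continuous_const.add continuous_id).mul continuous_const).tendsto' _ _ rfl)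
    exact (((h1.and h2).filter_mono nhdsWithin_le_nhds).and
      (self_mem_nhdsWithin : Set.Ioi (0 : ℝ) ∈ 𝓝[>] (0 : ℝ))).exists
  -- then `δ > 0` absorbing the `H¹`-perturbation AND the viscosity shift `|ν' − ν| < δ`
  obtain ⟨δ, ⟨hδE, hδε, hδν, hδa⟩, hδ0⟩ : ∃ δ : ℝ, ((1 + η) * A₀ + (1 + η⁻¹) * δ < E ∧
      (1 + η) * ε < (ν - δ) * (G₀ - (1 + η⁻¹) * δ) ∧ δ < ν ∧ δ < a - ν) ∧ 0 < δ := by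
    have h1 : ∀ᶠ δ : ℝ in 𝓝 0, (1 + η) * A₀ + (1 + η⁻¹) * δ < E :=
      Filter.Tendsto.eventually_lt_const (v := (1 + η) * A₀ + (1 + η⁻¹) * 0) (by simpa using hηE)
        ((continuous_const.add (continuous_const.mul continuous_id)).tendsto' _ _ rfl)
    have h2 : ∀ᶠ δ : ℝ in 𝓝 0, (1 + η) * ε < (ν - δ) * (G₀ - (1 + η⁻¹) * δ) :=
      Filter.Tendsto.eventually_const_lt (v := (ν - 0) * (G₀ - (1 + η⁻¹) * 0))
        (by simpa using hηε)
        (((continuous_const.sub continuous_id).mul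
          (continuous_const.sub (continuous_const.mul continuous_id))).tendsto' _ _ rfl)
    have h3 : ∀ᶠ δ : ℝ in 𝓝 0, δ < ν := eventually_lt_nhds hν
    have h4 : ∀ᶠ δ : ℝ in 𝓝 0, δ < a - ν := eventually_lt_nhds (by linarith)
    exact (((h1.and (h2.and (h3.and h4))).filter_mono nhdsWithin_le_nhds).and
      (self_mem_nhdsWithin : Set.Ioi (0 : ℝ) ∈ 𝓝[>] (0 : ℝ))).exists
  -- persistence gives a ball of forces with `(ν', u')` close to `(ν, u₀)` in `ℝ × H¹`
  obtain ⟨r, hr, hball⟩ := hpers δ hδ0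
  have hsub : Metric.ball c r ⊆ loud S a E ε := by
    intro c' hc'
    obtain ⟨ν', u', p', hν', hst', hdist⟩ := hball c' (Metric.mem_ball.1 hc')
    have hsm' : IsSmooth u' := hst'.smooth_velocity.isSmooth_slice (Set.mem_univ (0 : ℝ))
    -- the viscosity window `ν − δ < ν' < ν + δ`, inside `(0, a)`
    obtain ⟨hν'l, hν'r⟩ := abs_lt.1 hν'
    have hν'pos : 0 < ν' := by linarith
    have hν'a : ν' < a := by linarith
    -- split the squared `H¹` distance into its two nonnegative parts
    have hL2 : 0 ≤ ∫ x, ‖u' x - u₀ x‖ ^ 2 := integral_nonneg fun _ => sq_nonneg _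
    have hH1 : 0 ≤ gradNormSq (fun x => u' x - u₀ x) := gradNormSq_nonneg _
    have hdist' : (∫ x, ‖u' x - u₀ x‖ ^ 2) + gradNormSq (fun x => u' x - u₀ x) < δ := hdist
    have hdL : ∫ x, ‖u' x - u₀ x‖ ^ 2 ≤ δ := by linarith
    have hdG : gradNormSq (fun x => u' x - u₀ x) ≤ δ := by linarith
    have hη1 : 0 ≤ 1 + η⁻¹ := by positivity
    -- energy budget `∫‖u'‖² ≤ E`
    have hEn : meanEnergy (fun _ : ℝ => u') ≤ E := by
      rw [meanEnergy_const]
      have h := integral_norm_sq_le hsm₀.continuous hsm'.continuous hη0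
      have : (1 + η⁻¹) * ∫ x, ‖u' x - u₀ x‖ ^ 2 ≤ (1 + η⁻¹) * δ :=
        mul_le_mul_of_nonneg_left hdL hη1
      linarith
    -- dissipation budget `ε ≤ ν'‖∇u'‖₂²`
    have hDi : ε ≤ meanDissipation ν' (fun _ : ℝ => u') := by
      rw [meanDissipation_const ν' hsm']
      have h := gradNormSq_le hsm₀ hsm' hη0
      have hG' : 0 ≤ gradNormSq u' := gradNormSq_nonneg _
      have h1 : (1 + η⁻¹) * gradNormSq (fun x => u' x - u₀ x) ≤ (1 + η⁻¹) * δ :=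
        mul_le_mul_of_nonneg_left hdG hη1
      have h2 : (ν - δ) * (G₀ - (1 + η⁻¹) * δ) ≤ (ν - δ) * ((1 + η) * gradNormSq u') :=
        mul_le_mul_of_nonneg_left (by linarith) (by linarith)
      have h3 : (ν - δ) * ((1 + η) * gradNormSq u') ≤ ν' * ((1 + η) * gradNormSq u') :=
        mul_le_mul_of_nonneg_right (by linarith) (by positivity)
      have h4 : (1 + η) * ε < (1 + η) * (ν' * gradNormSq u') := by
        have e : ν' * ((1 + η) * gradNormSq u') = (1 + η) * (ν' * gradNormSq u') := by ring
        linarith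
      exact (lt_of_mul_lt_mul_left h4 (by linarith)).le
    -- pattern from Cruxes/RobustLoudUpgrade/Disproof.lean §6 `cLam_mem_loud`
    exact ⟨ν', hν'pos, hν'a, 1, fun _ => u', fun _ => p', one_pos, hst', fun _ => rfl, hEn, hDi⟩
  exact interior_mono hsub (by rwa [Metric.isOpen_ball.interior_eq, Metric.mem_ball, dist_self])

end Summit.AnomalousDissipation.AnomalousDissipation.Theorems.RobustLoudUpgrade.SteadyWindowNear

end
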